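import Mathlib
import HarnessLib
import Summits.HubbardSuperconductivity.Statement
import Literature.MathematicalPhysics.QuantumLattice.DWaveSource

/-!
# Route `AposterioriCapRg` — the Assembly (item `stmt-HubbardSuperconductivity-1316`)

The assembly item of route `HubbardSuperconductivity/AposterioriCapRg` is the curried
implication `Assembly := SsbToEvenTorusLro → FixedPointDWaveOrder → HubbardSuperconductivity`:
pure logic over the summit Statement (same content as the route's deciding theorem `closes`,
arguments swapped). `FixedPointDWaveOrder` delivers a point `U ∈ [2,3]`, `δ ∈ [1/5, 7/20]` and
a chemical potential `μ` with grand-canonical tracial ground-state density `→ 1 - δ` and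
Koma–Tasaki `d`-wave order `HasDWaveOrder U μ`; `SsbToEvenTorusLro` turns that, for every
`U > 0`, `δ ∈ (0,1)`, into `d_{x²-y²}` pair-field long-range order of EVERY normalised
`(N_L, S^z = 0)`-sector ground-state sequence of `hubbardTorus 2 L 1 U` along even sides — the
body of `Literature.Hubbard.DWaveSuperconductivityHubbard`, the definiens of the summit
statement, word for word. Arithmetic: `2 ≤ U ⇒ 0 < U`, `[1/5, 7/20] ⊂ (0, 1/2) ⊂ (0, 1)`.

DESIGN (summit precedent: `Theorems/BalabanIRAssemblyFrame.lean`,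
`Theorems/ThermalWedgeAssemblyStructural.lean`): this module does NOT import the route module
`Summits.HubbardSuperconductivity.HubbardSuperconductivity.Theses.AposterioriCapRg`. When the
item closes, the gate re-renders the route file with `import <this module>` and
`theorem Assembly_holds : Assembly := _root_.<this theorem>`; a closing module that itself
imports the route module would close an import cycle (the failure that detached
`Theorems/BalabanIRAssembly.lean` and `Theorems/ThermalWedgeAssembly.lean`). So the TYPE below
is spelled out STRUCTURALLY — the verbatim bodies of the route decls `SsbToEvenTorusLro` and
`FixedPointDWaveOrder` (Theses/AposterioriCapRg.lean, items stmt-HubbardSuperconductivity-1315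
and stmt-HubbardSuperconductivity-1313) and the summit constant `_root_.HubbardSuperconductivity`
— so that it is definitionally (by `δ`-unfolding of the three defs only) the route decl
`Summit.HubbardSuperconductivity.HubbardSuperconductivity.Theses.AposterioriCapRg.Assembly`
(checked in a scratch file importing the Theses module:
`example : AposterioriCapRg.Assembly := aposterioriCapRg_assembly_proof`, rc 0), and the route
file can import this module without a cycle. Imports: `Summits.HubbardSuperconductivity.Statement`,
`Literature.MathematicalPhysics.QuantumLattice.DWaveSource` (for `HasDWaveOrder`), Mathlib,
HarnessLib. No analysis, no new definitions.
-/

namespace Summit.HubbardSuperconductivity.HubbardSuperconductivity.Theorems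

open scoped Matrix ComplexOrder

/-- **Assembly of route `AposterioriCapRg`** (item `stmt-HubbardSuperconductivity-1316`), stated
structurally: (every-ground-state transfer on even tori `SsbToEvenTorusLro`) → (fixed-point
`d`-wave order `FixedPointDWaveOrder`) → `HubbardSuperconductivity`, both hypotheses written out
verbatim so that this type unfolds to
`Summit.HubbardSuperconductivity.HubbardSuperconductivity.Theses.AposterioriCapRg.Assembly` by
`δ`-reduction alone. Proof: destructure the fixed point `(U, δ, μ)` with its density clause and
`HasDWaveOrder U μ`; `0 < U` from `2 ≤ U`, `δ ∈ (0,1)` and `δ ∈ (0,1/2)` from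
`δ ∈ [1/5, 7/20]` (`linarith`); apply the transfer to the Statement's `(N, ψ)`. [folklore] -/
theorem aposterioriCapRg_assembly_proof :
    (∀ (U δ μ : ℝ), 0 < U → δ ∈ Set.Ioo (0:ℝ) 1 → Filter.Tendsto (fun L : ℕ => ((Literature.MathematicalPhysics.QuantumLattice.hubbardTorusWith 2 (L + 1) 1 U μ).groundStateFunctional Literature.MathematicalPhysics.QuantumLattice.totalNumber).re / ((L + 1 : ℕ) : ℝ) ^ 2) Filter.atTop (nhds (1 - δ)) → Literature.MathematicalPhysics.QuantumLattice.HasDWaveOrder U μ → ∀ (N : ℕ → ℕ) (ψ : ∀ L, Literature.MathematicalPhysics.QuantumLattice.Fock (Literature.MathematicalPhysics.QuantumLattice.Orb (Literature.MathematicalPhysics.QuantumLattice.FermionTorus 2 L))), (∀ L, Even L → N L = 2 * ⌊(1 - δ) * (L : ℝ) ^ 2 / 2⌋₊ ∧ star (ψ L) ⬝ᵥ ψ L = 1 ∧ Literature.MathematicalPhysics.QuantumLattice.IsGroundStateInSector (Literature.MathematicalPhysics.QuantumLattice.hubbardTorus 2 L 1 U) (N L) 0 (ψ L)) → Literature.Probability.LatticeModels.HasLongRangeOrder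 (fun k => Literature.Probability.LatticeModels.halfOpenBox 2 (2 * k)) (fun k => Literature.MathematicalPhysics.QuantumLattice.torusPullback (Literature.MathematicalPhysics.QuantumLattice.pairFieldCorr Literature.MathematicalPhysics.QuantumLattice.dWaveFormFactor ψ) (2 * k))) →
      (∃ U ∈ Set.Icc (2:ℝ) 3, ∃ δ ∈ Set.Icc (1/5:ℝ) (7/20), ∃ μ : ℝ, Filter.Tendsto (fun L : ℕ => ((Literature.MathematicalPhysics.QuantumLattice.hubbardTorusWith 2 (L + 1) 1 U μ).groundStateFunctional Literature.MathematicalPhysics.QuantumLattice.totalNumber).re / ((L + 1 : ℕ) : ℝ) ^ 2) Filter.atTop (nhds (1 - δ)) ∧ Literature.MathematicalPhysics.QuantumLattice.HasDWaveOrder U μ) →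
        _root_.HubbardSuperconductivity := by
  intro hS hT
  obtain ⟨U, hU, δ, hδ, μ, hdens, hord⟩ := hT
  have hU0 : (0 : ℝ) < U := by linarith [hU.1]
  have hδ' : δ ∈ Set.Ioo (0 : ℝ) 1 := ⟨by linarith [hδ.1], by linarith [hδ.2]⟩
  show Literature.Hubbard.DWaveSuperconductivityHubbard
  refine ⟨U, hU0, δ, ⟨by linarith [hδ.1], by linarith [hδ.2]⟩, ?_⟩
  intro N ψ hψ
  exact hS U δ μ hU0 hδ' hdens hord N ψ hψ

end Summit.HubbardSuperconductivity.HubbardSuperconductivity.Theorems
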